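import Summits.ValiantsHypothesis.ValiantsHypothesis.Theorems.MonotoneRestorationOrbitRestorationQPTermBlocksRelSupport
import HarnessLib

/-!
# Value-permuted term systems blocked by an equivariant LABEL with untwisted stabilisers restore (keyed kind (P))

Route MonotoneRestoration, crux `OrbitRestorationQP` (stmt-ValiantsHypothesis-18293), line `depth-three-rung`, rung
`A_∞ = stub_sigmaPiSigmaValue`; namespace `Summit.ValiantsHypothesis.ValiantsHypothesis.Theorems.TermBlocks`.

`qpOrbitRestorable_of_untwisted_relSupportBlocks` (`…TermBlocksRelSupport.lean`) blocks the factors of a value-permuted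
term system by their support relative to the key of the term.  When those blocks are still twisted one needs FINER or
COARSER blockings chosen ad hoc — in the one-product case this is the passage from support blocks (XVII) to KEYED blocks
(XXI).  The transport argument does not care what the blocks are, only that the blocking is a LABEL
`lab t ℓ ∈ Λ` (`Λ` a finite `Sym(Fin n)`-set) which is (L1) blind to units, (L2) equivariant
(`lab (σ • t) (σ · ℓ) = σ • lab t ℓ`), (L3) controls supports (every factor with label `λ` in the term `t` is fixed by the
pointwise stabiliser of a set `K t λ` of `≤ k` indices), and (TBˡ) has untwisted stabilisers
(`ρ • t = t`, `ρ • λ = λ` ⇒ `ρ` fixes `Π {ℓ ∈ L_t : lab t ℓ = λ}`).  Then (`qpOrbitRestorable_of_untwisted_labelBlocks`)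
`Σ_t a_t Π L_t` is `QPOrbitRestorable (k + 5)`.  Labels in use: `lab t ℓ = supp ℓ ∖ key t` (relative support blocks,
`…TermBlocksRelSupport.lean`), `lab t ℓ = supp ℓ` (support blocks), `lab t ℓ = (key' ℓ, supp ℓ)` (keyed sub-blocks), or
coarser labels merging classes whose characters cancel.

* `exists_unit_labelBlock`, `card_labelBlock_smul` — unique factorisation transports label blocks up to units along the
  term system and preserves their size;
* `qpOrbitRestorable_of_untwisted_labelBlocks` — the theorem.

Honest label: positive-lane tool (the freedom of the blocking made explicit); the stub, the crux and VP ≠ VNP are not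
moved.  Everything is proved. [folklore]

## References
* A. Dawar, G. Wilsenach, *Symmetric arithmetic circuits*, ToC 21 (2025), §3.3, Def. 6.1. [DawarWilsenach2025]
-/

noncomputable section

open scoped Classical Pointwise

-- `Summit.ValiantsHypothesis.ValiantsHypothesis.…` is the tree's single-conjunct layout (Sub = Summit).
set_option linter.dupNamespace false

namespace Summit.ValiantsHypothesis.ValiantsHypothesis.Theorems

namespace TermBlocks

open Equiv Finset Literature.Computability.AlgebraicComplexity OrbitRestorationQPDepthThreeRung SupportBlocks

variable {n : ℕ}

/-- **Label blocks are transported up to units along a value-permuted term system.** [folklore] -/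
theorem exists_unit_labelBlock {T Λ : Type} [MulAction (Perm (Fin n)) T] [MulAction (Perm (Fin n)) Λ]
    (a : T → ℂ) (L : T → Multiset (MvPolynomial (Fin n × Fin n) ℂ))
    (lab : T → MvPolynomial (Fin n × Fin n) ℂ → Λ)
    (L1 : ∀ (t : T) (q : MvPolynomial (Fin n × Fin n) ℂ) (u : ℂ), u ≠ 0 → lab t (MvPolynomial.C u * q) = lab t q)
    (L2 : ∀ (σ : Perm (Fin n)) (t : T) (q : MvPolynomial (Fin n × Fin n) ℂ), lab (σ • t) (ren σ q) = σ • lab t q)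
    (hL1 : ∀ t, ∀ ℓ ∈ L t, ℓ.totalDegree = 1) (ha0 : ∀ t, a t ≠ 0)
    (hF : ∀ (σ : Perm (Fin n)) (t : T), ren σ (MvPolynomial.C (a t) * (L t).prod) =
      MvPolynomial.C (a (σ • t)) * (L (σ • t)).prod)
    (σ : Perm (Fin n)) (t : T) (l : Λ) :
    ∃ c : ℂ, c ≠ 0 ∧ ren σ ((L t).filter fun ℓ => lab t ℓ = l).prod =
      MvPolynomial.C c * ((L (σ • t)).filter fun ℓ => lab (σ • t) ℓ = σ • l).prod := by
  have hP : ∀ p q : MvPolynomial (Fin n × Fin n) ℂ, Associated p q →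
      (lab (σ • t) p = σ • l ↔ lab (σ • t) q = σ • l) := by
    intro p q hpq
    obtain ⟨c, hc0, rfl⟩ := exists_C_of_associated hpq
    rw [L1 _ p c hc0]
  have h1 := map_mk_filter_eq hP (map_mk_map_ren_eq_of_terms a L hL1 ha0 hF σ t)
  have h2 : ((L t).map (ren σ)).filter (fun ℓ => lab (σ • t) ℓ = σ • l) =
      ((L t).filter fun ℓ => lab t ℓ = l).map (ren σ) := by
    rw [Multiset.filter_map]
    congr 1
    refine Multiset.filter_congr fun ℓ _ => ?_
    simp only [Function.comp_apply, L2]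
    constructor
    · intro h; simpa using congrArg (fun x => σ⁻¹ • x) h
    · intro h; rw [h]
  rw [h2] at h1
  have h3 := congrArg Multiset.prod h1
  rw [Associates.prod_mk, Associates.prod_mk, Associates.mk_eq_mk_iff_associated, ← map_multiset_prod] at h3
  obtain ⟨c, hc0, hc⟩ := exists_C_of_associated h3.symm
  exact ⟨c, hc0, hc⟩

/-- **Label blocks along an orbit have the same size.** [folklore] -/
theorem card_labelBlock_smul {T Λ : Type} [MulAction (Perm (Fin n)) T] [MulAction (Perm (Fin n)) Λ]
    (a : T → ℂ) (L : T → Multiset (MvPolynomial (Fin n × Fin n) ℂ))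
    (lab : T → MvPolynomial (Fin n × Fin n) ℂ → Λ)
    (L1 : ∀ (t : T) (q : MvPolynomial (Fin n × Fin n) ℂ) (u : ℂ), u ≠ 0 → lab t (MvPolynomial.C u * q) = lab t q)
    (L2 : ∀ (σ : Perm (Fin n)) (t : T) (q : MvPolynomial (Fin n × Fin n) ℂ), lab (σ • t) (ren σ q) = σ • lab t q)
    (hL1 : ∀ t, ∀ ℓ ∈ L t, ℓ.totalDegree = 1) (ha0 : ∀ t, a t ≠ 0)
    (hF : ∀ (σ : Perm (Fin n)) (t : T), ren σ (MvPolynomial.C (a t) * (L t).prod) =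
      MvPolynomial.C (a (σ • t)) * (L (σ • t)).prod)
    (σ : Perm (Fin n)) (t : T) (l : Λ) :
    Multiset.card ((L (σ • t)).filter fun ℓ => lab (σ • t) ℓ = σ • l) =
      Multiset.card ((L t).filter fun ℓ => lab t ℓ = l) := by
  have hP : ∀ p q : MvPolynomial (Fin n × Fin n) ℂ, Associated p q →
      (lab (σ • t) p = σ • l ↔ lab (σ • t) q = σ • l) := by
    intro p q hpq
    obtain ⟨c, hc0, rfl⟩ := exists_C_of_associated hpq
    rw [L1 _ p c hc0]
  have h1 := map_mk_filter_eq hP (map_mk_map_ren_eq_of_terms a L hL1 ha0 hF σ t)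
  have h2 : ((L t).map (ren σ)).filter (fun ℓ => lab (σ • t) ℓ = σ • l) =
      ((L t).filter fun ℓ => lab t ℓ = l).map (ren σ) := by
    rw [Multiset.filter_map]
    congr 1
    refine Multiset.filter_congr fun ℓ _ => ?_
    simp only [Function.comp_apply, L2]
    constructor
    · intro h; simpa using congrArg (fun x => σ⁻¹ • x) h
    · intro h; rw [h]
  rw [h2] at h1
  have h3 := congrArg Multiset.card h1
  simp only [Multiset.card_map] at h3
  exact h3.symm

/-- **VALUE-PERMUTED TERM SYSTEMS WITH AN UNTWISTED EQUIVARIANT BLOCK LABEL ARE ORBIT-RESTORABLE.**  Terms `t` in a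
finite `Sym(Fin n)`-set, each fixed by the pointwise stabiliser of a set `key t` of `≤ k` indices; `p = Σ_t a_t Π L_t`,
`a_t ≠ 0`, degree-one factors, terms permuted as values; a label `lab t ℓ` in a finite `Sym(Fin n)`-set `Λ`, blind to
units (L1) and equivariant (L2), such that (L3) every factor of `t` with label `λ` is fixed by the pointwise stabiliser of
a set `K t λ` of `≤ k` indices, and (TBˡ) every `ρ` with `ρ • t = t`, `ρ • λ = λ` fixes `Π {ℓ ∈ L_t : lab t ℓ = λ}`.  Then
`p` is `QPOrbitRestorable (k + 5)` at level `n`. [folklore; cite: DawarWilsenach2025, §3.3 and Def. 6.1] -/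
theorem qpOrbitRestorable_of_untwisted_labelBlocks {k : ℕ} {T Λ : Type} [Fintype T] [Fintype Λ]
    [MulAction (Perm (Fin n)) T] [MulAction (Perm (Fin n)) Λ]
    (a : T → ℂ) (L : T → Multiset (MvPolynomial (Fin n × Fin n) ℂ))
    (key : T → Finset (Fin n)) (hkeyk : ∀ t, (key t).card ≤ k)
    (hTfix : ∀ (t : T) (σ : Perm (Fin n)), (∀ x ∈ key t, σ x = x) → σ • t = t)
    (lab : T → MvPolynomial (Fin n × Fin n) ℂ → Λ)
    (L1 : ∀ (t : T) (q : MvPolynomial (Fin n × Fin n) ℂ) (u : ℂ), u ≠ 0 → lab t (MvPolynomial.C u * q) = lab t q)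
    (L2 : ∀ (σ : Perm (Fin n)) (t : T) (q : MvPolynomial (Fin n × Fin n) ℂ), lab (σ • t) (ren σ q) = σ • lab t q)
    (K : T → Λ → Finset (Fin n)) (hKk : ∀ t l, (K t l).card ≤ k)
    (L3 : ∀ t, ∀ ℓ ∈ L t, ∀ τ : Perm (Fin n), (∀ x ∈ K t (lab t ℓ), τ x = x) → ren τ ℓ = ℓ)
    (hL1 : ∀ t, ∀ ℓ ∈ L t, ℓ.totalDegree = 1) (ha0 : ∀ t, a t ≠ 0)
    (hF : ∀ (σ : Perm (Fin n)) (t : T), ren σ (MvPolynomial.C (a t) * (L t).prod) =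
      MvPolynomial.C (a (σ • t)) * (L (σ • t)).prod)
    (hTB : ∀ (ρ : Perm (Fin n)) (t : T) (l : Λ), ρ • t = t → ρ • l = l →
      ren ρ ((L t).filter fun ℓ => lab t ℓ = l).prod = ((L t).filter fun ℓ => lab t ℓ = l).prod) :
    QPOrbitRestorable (k + 5) n (∑ t, MvPolynomial.C (a t) * (L t).prod) := by
  -- the label blocks, indexed by pairs (term, label)
  set M : T × Λ → Multiset (MvPolynomial (Fin n × Fin n) ℂ) :=
    fun b => (L b.1).filter fun ℓ => lab b.1 ℓ = b.2 with hM
  have hterm : ∀ t : T, ∏ b ∈ univ.filter (fun b : T × Λ => b.1 = t), (M b).prod = (L t).prod := by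
    intro t
    rw [prod_filter, Fintype.prod_prod_type_right]
    simp only [prod_ite_eq', mem_univ, if_true, hM]
    exact prod_filter_eq_prod (fun ℓ => lab t ℓ) (L t)
  have hsum : (∑ t, MvPolynomial.C (a t) * (L t).prod) =
      ∑ t, MvPolynomial.C (a t) * ∏ b ∈ univ.filter (fun b : T × Λ => b.1 = t), (M b).prod := by
    simp only [hterm]
  rw [hsum]
  refine qpOrbitRestorable_of_termBlocks_stab (k := k) Prod.fst (fun σ b => rfl) M a
    (fun b q hq => hL1 b.1 q (Multiset.mem_filter.1 hq).1) (fun b q hq => ?_) (fun b => ?_) (fun σ b => ?_)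
    (fun σ b => ?_) (fun ρ b hb => ?_) (fun t _ => ⟨key t, hkeyk t, hTfix t⟩) (fun σ t => ?_)
  · -- supported forms
    obtain ⟨hqL, hql⟩ := Multiset.mem_filter.1 hq
    exact ⟨K b.1 (lab b.1 q), hKk _ _, L3 b.1 q hqL⟩
  · -- exactly permuted by the pointwise stabiliser of `K t λ`
    refine ⟨K b.1 b.2, hKk _ _, fun τ hτ => ?_⟩
    have hfix : ∀ q ∈ M b, ren τ q = q := by
      intro q hq
      obtain ⟨hqL, hql⟩ := Multiset.mem_filter.1 hq
      exact L3 b.1 q hqL τ (by rw [hql]; exact hτ)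
    conv_rhs => rw [← Multiset.map_id (M b)]
    exact Multiset.map_congr rfl fun q hq => by rw [hfix q hq, id]
  · -- blocks along an orbit have the same size
    show Multiset.card ((L (σ • b).1).filter fun ℓ => lab (σ • b).1 ℓ = (σ • b).2) =
      Multiset.card ((L b.1).filter fun ℓ => lab b.1 ℓ = b.2)
    exact card_labelBlock_smul a L lab L1 L2 hL1 ha0 hF σ b.1 b.2
  · -- projective equivariance of the label blocks
    exact exists_unit_labelBlock a L lab L1 L2 hL1 ha0 hF σ b.1 b.2
  · -- untwisted stabilisers
    exact hTB ρ b.1 b.2 (congrArg Prod.fst hb) (congrArg Prod.snd hb)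
  · -- the terms are permuted as values
    rw [hterm, hterm]; exact hF σ t

/-- **THE SAME WITH WIDE BLOCKS** (support control split): every factor is fixed by the pointwise stabiliser of its
OWN small set (L3a), and every label block, possibly of unbounded size, is mapped to itself as a multiset by the
pointwise stabiliser of one small set (L3b) — e.g. the block `{x_{ij'} + x_{ik} − x_{i'j'} − x_{i'k} : k ∉ {j,j'}}` of all
`(i i')`-alternating factors of a term keyed by `(j, j')`, which is permuted exactly by the pointwise stabiliser of
`{i, i', j, j'}` although its members have `n − 2` different supports.  Conclusion as before: `QPOrbitRestorable (k + 5)`.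
[folklore; cite: DawarWilsenach2025, §3.3 and Def. 6.1] -/
theorem qpOrbitRestorable_of_untwisted_labelBlocks_wide {k : ℕ} {T Λ : Type} [Fintype T] [Fintype Λ]
    [MulAction (Perm (Fin n)) T] [MulAction (Perm (Fin n)) Λ]
    (a : T → ℂ) (L : T → Multiset (MvPolynomial (Fin n × Fin n) ℂ))
    (key : T → Finset (Fin n)) (hkeyk : ∀ t, (key t).card ≤ k)
    (hTfix : ∀ (t : T) (σ : Perm (Fin n)), (∀ x ∈ key t, σ x = x) → σ • t = t)
    (lab : T → MvPolynomial (Fin n × Fin n) ℂ → Λ)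
    (L1 : ∀ (t : T) (q : MvPolynomial (Fin n × Fin n) ℂ) (u : ℂ), u ≠ 0 → lab t (MvPolynomial.C u * q) = lab t q)
    (L2 : ∀ (σ : Perm (Fin n)) (t : T) (q : MvPolynomial (Fin n × Fin n) ℂ), lab (σ • t) (ren σ q) = σ • lab t q)
    (L3a : ∀ t, ∀ ℓ ∈ L t, ∃ X : Finset (Fin n), X.card ≤ k ∧
      ∀ τ : Perm (Fin n), (∀ x ∈ X, τ x = x) → ren τ ℓ = ℓ)
    (L3b : ∀ (t : T) (l : Λ), ∃ K : Finset (Fin n), K.card ≤ k ∧ ∀ τ : Perm (Fin n), (∀ x ∈ K, τ x = x) →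
      ((L t).filter fun ℓ => lab t ℓ = l).map (ren τ) = (L t).filter fun ℓ => lab t ℓ = l)
    (hL1 : ∀ t, ∀ ℓ ∈ L t, ℓ.totalDegree = 1) (ha0 : ∀ t, a t ≠ 0)
    (hF : ∀ (σ : Perm (Fin n)) (t : T), ren σ (MvPolynomial.C (a t) * (L t).prod) =
      MvPolynomial.C (a (σ • t)) * (L (σ • t)).prod)
    (hTB : ∀ (ρ : Perm (Fin n)) (t : T) (l : Λ), ρ • t = t → ρ • l = l →
      ren ρ ((L t).filter fun ℓ => lab t ℓ = l).prod = ((L t).filter fun ℓ => lab t ℓ = l).prod) :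
    QPOrbitRestorable (k + 5) n (∑ t, MvPolynomial.C (a t) * (L t).prod) := by
  set M : T × Λ → Multiset (MvPolynomial (Fin n × Fin n) ℂ) :=
    fun b => (L b.1).filter fun ℓ => lab b.1 ℓ = b.2 with hM
  have hterm : ∀ t : T, ∏ b ∈ univ.filter (fun b : T × Λ => b.1 = t), (M b).prod = (L t).prod := by
    intro t
    rw [prod_filter, Fintype.prod_prod_type_right]
    simp only [prod_ite_eq', mem_univ, if_true, hM]
    exact prod_filter_eq_prod (fun ℓ => lab t ℓ) (L t)
  have hsum : (∑ t, MvPolynomial.C (a t) * (L t).prod) =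
      ∑ t, MvPolynomial.C (a t) * ∏ b ∈ univ.filter (fun b : T × Λ => b.1 = t), (M b).prod := by
    simp only [hterm]
  rw [hsum]
  refine qpOrbitRestorable_of_termBlocks_stab (k := k) Prod.fst (fun σ b => rfl) M a
    (fun b q hq => hL1 b.1 q (Multiset.mem_filter.1 hq).1)
    (fun b q hq => L3a b.1 q (Multiset.mem_filter.1 hq).1) (fun b => L3b b.1 b.2) (fun σ b => ?_)
    (fun σ b => ?_) (fun ρ b hb => ?_) (fun t _ => ⟨key t, hkeyk t, hTfix t⟩) (fun σ t => ?_)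
  · show Multiset.card ((L (σ • b).1).filter fun ℓ => lab (σ • b).1 ℓ = (σ • b).2) =
      Multiset.card ((L b.1).filter fun ℓ => lab b.1 ℓ = b.2)
    exact card_labelBlock_smul a L lab L1 L2 hL1 ha0 hF σ b.1 b.2
  · exact exists_unit_labelBlock a L lab L1 L2 hL1 ha0 hF σ b.1 b.2
  · exact hTB ρ b.1 b.2 (congrArg Prod.fst hb) (congrArg Prod.snd hb)
  · rw [hterm, hterm]; exact hF σ t

end TermBlocks

end Summit.ValiantsHypothesis.ValiantsHypothesis.Theorems

end
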